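import Mathlib
import Summits.ValiantsHypothesis.ValiantsHypothesis.Theses.RigidityForcesSymmetry
import Summits.ValiantsHypothesis.ValiantsHypothesis.Theorems.BorderApolarityToricWitnessObstructionQPStubTorusBound
import Summits.ValiantsHypothesis.ValiantsHypothesis.Theorems.RigidityForcesSymmetryRigidityForcesTorus
import Summits.ValiantsHypothesis.ValiantsHypothesis.Theorems.RigidityForcesSymmetryRigidMinimalReprStubTightStructure
import Summits.ValiantsHypothesis.ValiantsHypothesis.Theorems.RigidityForcesSymmetryRigidMinimalReprStubLevelOneComb
import Summits.ValiantsHypothesis.ValiantsHypothesis.Theorems.RigidityForcesSymmetryRigidMinimalReprStubRankJump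
import Summits.ValiantsHypothesis.ValiantsHypothesis.Theorems.RigidityForcesSymmetryRigidMinimalReprStubRowTwist
import Literature.Computability.AlgebraicComplexity.PermanentVsDeterminantProofs

/-!
# Route RigidityForcesSymmetry — crux `RigidMinimalRepr` (stmt-ValiantsHypothesis-4163) is FALSE

`not_RigidMinimalRepr : ¬ RigidMinimalRepr` (refuted-substantive).  Composition (line `registered`, run to
the negative side by the lead c1):

* `rigidityForcesTorus_proof` (stmt-4166, proved): a locally open `GL_n × GL_n`-orbit makes `Ã = Λ + Σ x_v A_v`
  two-sided-torus-equivariant with exact lifts;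
* `BorderApolarityToricWitnessObstructionQP.stub_torusBound` (stmt-4164, proved): then `2^m - 1 ≤ n`;
* Grenet's bound `determinantalComplexity_perPoly_le_holds` and minimality `n = dc(perm_m)`: `n = 2^m - 1`;
* `stub_tightNotRigid` (this file): in the tight case the orbit is never locally open.  By
  `stub_tightStructure` the conjugate `A' = g Ã h⁻¹` is a graded monomial matrix; its level-1 rows are indexed by
  cells `(k, l)` meeting every permutation graph, so (`stub_level1Comb`) two of them, `w₁, w₂`, share a row- or
  column-index and a third `w₃` exists; each level-1 row is `c_i x_{u_i} e_{c₀}ᵀ + e_{e_i}ᵀ`.  The Koszul row twist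
  `E_t = 1 + e_{w₃}(tα x_{u₁} e_{w₂}ᵀ + tβ x_{u₂} e_{w₁}ᵀ)` (`α c₂ + β c₁ = 0`, `stub_rowTwist`) has `det E_t = 1` and
  `E_t A' = A' + e_{w₃}(tα x_{u₁} e_{e₂}ᵀ + tβ x_{u₂} e_{e₁}ᵀ)` — affine again; conjugating back gives a continuous
  path `t ↦ (Λ, A + t N)` inside `{det = perm_m}` through `(Λ, A)`.  Rigidity would put `(Λ, A + tN)` in the
  orbit for small `t ≠ 0`, so every coefficient matrix would keep its rank (`g A_v h⁻¹`); but the coefficient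
  matrix of `x_{u₁}` (or `x_{u₂}`) acquires the non-zero entry `tα` at `(w₃, e₂)` in a row and a column where it
  vanished (grading + the shared index), and its rank jumps (`stub_rankJump`).  Contradiction.

So no minimal affine determinantal representation of `perm_m`, `m ≥ 3`, has a locally open orbit: the crux is
false as stated (refuted-substantive: the load-bearing claim fails for every `n ≥ 3`, not by a missing side
condition; the route `RigidityForcesSymmetry` cannot reach `GrenetLowerBound` through it).

Convention of the tree's LR17 files: `m` = size of the permanent, `n` = size of the matrix.
-/

/-- **Record of the dropped route item `RigidMinimalRepr`** = stmt-ValiantsHypothesis-4163 (ledger signature verbatim; NOT a route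
item): route RigidityForcesSymmetry rev 3 (2026-08-17T10:50Z) dropped the refuted crux `RigidMinimalRepr` (refuted-substantive by `not_RigidMinimalRepr` below; item closed `refuted`). The declaration `Summit.ValiantsHypothesis.ValiantsHypothesis.Theses.RigidityForcesSymmetry.RigidMinimalRepr`
therefore no longer exists in the route file and this accepted module stopped elaborating (stale olean;
buildfix lane 2026-08-19). Re-created here under its original name so the result keeps building; the
statement of every previously accepted declaration in this file is unchanged. -/
def _root_.Summit.ValiantsHypothesis.ValiantsHypothesis.Theses.RigidityForcesSymmetry.RigidMinimalRepr : Prop :=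
  ∀ n₀ : ℕ, ∃ n ≥ n₀, ∃ (m : ℕ) (Λ : Matrix (Fin m) (Fin m) ℂ) (A : Fin n × Fin n → Matrix (Fin m) (Fin m) ℂ), m = Literature.Computability.AlgebraicComplexity.determinantalComplexity (Literature.Computability.AlgebraicComplexity.perPoly (Fin n) ℂ) ∧ (Λ.map MvPolynomial.C + ∑ v, (MvPolynomial.X v : MvPolynomial (Fin n × Fin n) ℂ) • (A v).map MvPolynomial.C).det = Literature.Computability.AlgebraicComplexity.perPoly (Fin n) ℂ ∧ ∃ U ∈ nhds (Λ, A), ∀ p ∈ U, (p.1.map MvPolynomial.C + ∑ v, (MvPolynomial.X v : MvPolynomial (Fin n × Fin n) ℂ) • (p.2 v).map MvPolynomial.C).det = Literature.Computability.AlgebraicComplexity.perPoly (Fin n) ℂ → ∃ g h : GL (Fin m) ℂ, p.1 = (g : Matrix (Fin m) (Fin m) ℂ) * Λ * ((h⁻¹ : GL (Fin m) ℂ) : Matrix (Fin m) (Fin m) ℂ) ∧ ∀ v, p.2 v = (g : Matrix (Fin m) (Fin m) ℂ) * A v * ((h⁻¹ : GL (Fin m) ℂ) : Matrix (Fin m)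 (Fin m) ℂ)


open Matrix MvPolynomial Finset Module.End
open Literature.Computability.AlgebraicComplexity LRPencil
open Summit.ValiantsHypothesis.ValiantsHypothesis.Theses.RigidityForcesSymmetry

-- the mandated summit-side namespace repeats a component by design (single-problem summit)
set_option linter.dupNamespace false

namespace Summit.ValiantsHypothesis.ValiantsHypothesis.Theorems.RigidityForcesSymmetryRigidMinimalRepr

noncomputable section

/-! ### Small lemmas for the assembly -/

section Aux

variable {ι : Type*} {τ : Type*} [Fintype τ]

/-- The coefficient matrix of `x_v` in a pencil `Λ + Σ x_w A_w` is `A_v`. [folklore] -/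
theorem coeffMat_pencil [DecidableEq τ] (Λ : Matrix ι ι ℂ) (A : τ → Matrix ι ι ℂ) (v : τ) :
    coeffMat (Λ.map C + ∑ w, (X w : MvPolynomial τ ℂ) • (A w).map C : Matrix ι ι (MvPolynomial τ ℂ)) v = A v := by
  ext i j
  simp only [coeffMat_apply, Matrix.add_apply, Matrix.sum_apply, Matrix.smul_apply, Matrix.map_apply,
    smul_eq_mul, coeff_add, coeff_C, coeff_sum]
  rw [if_neg (fun h => one_ne_zero (Finsupp.single_eq_zero.1 h.symm)), zero_add]
  rw [Finset.sum_eq_single v]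
  · rw [mul_comm, coeff_C_mul, coeff_X, if_pos rfl, mul_one]
  · intro w _ hw
    rw [mul_comm, coeff_C_mul, coeff_X, if_neg (fun h => hw (Finsupp.single_left_injective one_ne_zero h)),
      mul_zero]
  · intro h; exact absurd (Finset.mem_univ v) h

end Aux

/-- `st` is injective in the cell `(k, l)`. [folklore] -/
theorem st_inj {m : ℕ} {k l k' l' : Fin m} (h : st k l = st k' l') : k = k' ∧ l = l' := by
  constructor
  · by_contra hk
    have h1 := congrFun h (Sum.inl k)
    rw [st_apply_inl, st_apply_of_ne (fun e => hk (Sum.inl_injective e)) Sum.inl_ne_inr] at h1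
    exact one_ne_zero h1
  · by_contra hl
    have h1 := congrFun h (Sum.inr l)
    rw [st_apply_inr, st_apply_of_ne Sum.inr_ne_inl (fun e => hl (Sum.inr_injective e))] at h1
    exact one_ne_zero h1

/-- Exponent arithmetic: `st k l = w + st k' l'` forces `w = 0` and `(k, l) = (k', l')`. [folklore] -/
theorem st_eq_add_st {m : ℕ} {k l k' l' : Fin m} {w : Fin m ⊕ Fin m → ℕ} (h : st k l = w + st k' l') :
    w = 0 ∧ k = k' ∧ l = l' := by
  have hk : k = k' := by
    by_contra hk
    have h1 := congrFun h (Sum.inl k')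
    rw [Pi.add_apply, st_apply_inl,
      st_apply_of_ne (fun e => hk (Sum.inl_injective e).symm) Sum.inl_ne_inr] at h1
    omega
  have hl : l = l' := by
    by_contra hl
    have h1 := congrFun h (Sum.inr l')
    rw [Pi.add_apply, st_apply_inr,
      st_apply_of_ne Sum.inr_ne_inl (fun e => hl (Sum.inr_injective e).symm)] at h1
    omega
  subst hk; subst hl
  refine ⟨funext fun x => ?_, rfl, rfl⟩
  have h1 := congrFun h x
  rw [Pi.add_apply] at h1
  rw [Pi.zero_apply]
  omega

/-- A `0/1`-valued exponent is never `st k l + st k' l'` for two cells in a common row or column. [folklore] -/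
theorem ne_st_add_st_of_share {m : ℕ} {ρ : Fin m ⊕ Fin m → ℕ} (hρ : ∀ x, ρ x ≤ 1) {k l k' l' : Fin m}
    (hsh : k = k' ∨ l = l') : ρ ≠ st k l + st k' l' := by
  intro h
  rcases hsh with rfl | rfl
  · have h1 := congrFun h (Sum.inl k)
    rw [Pi.add_apply, st_apply_inl, st_apply_inl] at h1
    have := hρ (Sum.inl k)
    omega
  · have h1 := congrFun h (Sum.inr l)
    rw [Pi.add_apply, st_apply_inr, st_apply_inr] at h1
    have := hρ (Sum.inr l)
    omega

/-- **The tight case is never locally rigid.** For `m ≥ 3` and `n = 2^m - 1`, a two-sided-torus-equivariant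
pencil `Λ + Σ x_v A_v` of determinant `perm_m` has representations of `perm_m` outside its `GL_n × GL_n`-orbit
in every neighbourhood of `(Λ, A)`: the Koszul row twist of the graded normal form. [folklore] -/
theorem stub_tightNotRigid {m n : ℕ} (hm : 3 ≤ m) (hn : n = 2 ^ m - 1)
    (Λ : Matrix (Fin n) (Fin n) ℂ) (A : Fin m × Fin m → Matrix (Fin n) (Fin n) ℂ)
    (hdet : (Λ.map C + ∑ v, (X v : MvPolynomial (Fin m × Fin m) ℂ) • (A v).map C).det = perPoly (Fin m) ℂ)
    (hA : IsEquivariantDetRepr (Subgroup.closure {γ : GL (Fin m × Fin m) ℂ | ∃ d e : Fin m → ℂ,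
        (γ : Matrix (Fin m × Fin m) (Fin m × Fin m) ℂ) = Matrix.diagonal (fun p => d p.1 * e p.2)})
      (perPoly (Fin m) ℂ) (Λ.map C + ∑ v, (X v : MvPolynomial (Fin m × Fin m) ℂ) • (A v).map C)) :
    ¬ ∃ U ∈ nhds (Λ, A), ∀ p ∈ U,
        (p.1.map C + ∑ v, (X v : MvPolynomial (Fin m × Fin m) ℂ) • (p.2 v).map C).det = perPoly (Fin m) ℂ →
        ∃ g h : GL (Fin n) ℂ, p.1 = (g : Matrix (Fin n) (Fin n) ℂ) * Λ * ((h⁻¹ : GL (Fin n) ℂ) : Matrix (Fin n) (Fin n) ℂ) ∧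
          ∀ v, p.2 v = (g : Matrix (Fin n) (Fin n) ℂ) * A v * ((h⁻¹ : GL (Fin n) ℂ) : Matrix (Fin n) (Fin n) ℂ) := by
  classical
  rintro ⟨U, hU, hrig⟩
  obtain ⟨g, h, ρ, θ, c₀, hρ1, -, hθinj, hθ0, hconst, hcoeff, hlev, hdiag⟩ := stub_tightStructure hm hn hA
  -- the conjugated pencil `A' = g Ã h⁻¹` and its coefficient data
  set P₀ : Matrix (Fin n) (Fin n) (MvPolynomial (Fin m × Fin m) ℂ) :=
    Λ.map C + ∑ v, (X v : MvPolynomial (Fin m × Fin m) ℂ) • (A v).map C with hP₀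
  set A' : Matrix (Fin n) (Fin n) (MvPolynomial (Fin m × Fin m) ℂ) :=
    (g : Matrix (Fin n) (Fin n) ℂ).map C * P₀ * ((h⁻¹ : GL (Fin n) ℂ) : Matrix (Fin n) (Fin n) ℂ).map C
    with hA'
  have hA'p : A' = ((g : Matrix (Fin n) (Fin n) ℂ) * Λ * ((h⁻¹ : GL (Fin n) ℂ) : Matrix (Fin n) (Fin n) ℂ)).map C +
      ∑ v, (X v : MvPolynomial (Fin m × Fin m) ℂ) •
        ((g : Matrix (Fin n) (Fin n) ℂ) * A v * ((h⁻¹ : GL (Fin n) ℂ) : Matrix (Fin n) (Fin n) ℂ)).map C := by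
    rw [hA', hP₀]; exact rft_map_C_mul_pencil_mul_map_C _ _ Λ A
  have hcoeffA' : ∀ v, coeffMat A' v =
      (g : Matrix (Fin n) (Fin n) ℂ) * A v * ((h⁻¹ : GL (Fin n) ℂ) : Matrix (Fin n) (Fin n) ℂ) := fun v => by
    rw [hA'p, coeffMat_pencil]
  have haff : ∀ i j, (A' i j).totalDegree ≤ 1 := fun i j => by
    rw [hA'p]; exact rft_totalDegree_pencil_le _ _ i j
  -- three level-1 cells, two of them in a common row or column
  obtain ⟨u₁, hu₁, u₂, hu₂, u₃, hu₃, h12, h13, h23, hsh⟩ :=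
    stub_level1Comb hm {u : Fin m × Fin m | ∃ r, ρ r = st u.1 u.2}
      (fun σ => by obtain ⟨k, r, hr⟩ := hlev σ; exact ⟨k, r, hr⟩)
  obtain ⟨w₁, hw₁⟩ := hu₁
  obtain ⟨w₂, hw₂⟩ := hu₂
  obtain ⟨w₃, hw₃⟩ := hu₃
  have hw13 : w₁ ≠ w₃ := by
    intro e
    have e' : st u₁.1 u₁.2 = st u₃.1 u₃.2 := by rw [← hw₁, ← hw₃, e]
    obtain ⟨ha, hb⟩ := st_inj e'
    exact h13 (Prod.ext ha hb)
  have hw23 : w₂ ≠ w₃ := by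
    intro e
    have e' : st u₂.1 u₂.2 = st u₃.1 u₃.2 := by rw [← hw₂, ← hw₃, e]
    obtain ⟨ha, hb⟩ := st_inj e'
    exact h23 (Prod.ext ha hb)
  obtain ⟨e₁, hθe₁, hd₁⟩ := hdiag w₁ u₁.1 u₁.2 hw₁
  obtain ⟨e₂, hθe₂, hd₂⟩ := hdiag w₂ u₂.1 u₂.2 hw₂
  -- the shape of a level-1 row
  have hrow : ∀ (w e : Fin n) (u : Fin m × Fin m), ρ w = st u.1 u.2 → θ e = st u.1 u.2 →
      constPart A' w e = 1 →
      ∀ j, A' w j = (if j = c₀ then C (coeffMat A' u w c₀) * X u else 0) + (if j = e then C 1 else 0) := by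
    intro w e u hw he hd j
    have hcst : ∀ j, j ≠ e → constPart A' w j = 0 := by
      intro j hj
      by_contra hne
      have h1 := hconst w j hne
      exact hj (hθinj (by rw [he, ← hw, h1]))
    have hcf : ∀ (v : Fin m × Fin m) (j : Fin n), (v ≠ u ∨ j ≠ c₀) → coeffMat A' v w j = 0 := by
      intro v j hvj
      by_contra hne
      have h1 := hcoeff v.1 v.2 w j hne
      rw [hw] at h1
      obtain ⟨hθj, hk, hl⟩ := st_eq_add_st h1
      have hj : j = c₀ := hθinj (by rw [hθj, hθ0])
      have hv : v = u := Prod.ext hk.symm hl.symm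
      rcases hvj with hvj | hvj
      · exact hvj hv
      · exact hvj hj
    have hdec := eq_affine_of_totalDegree_le_one (A' w j) (haff w j)
    have hc0 : coeff 0 (A' w j) = constPart A' w j := by
      rw [constPart_apply, constantCoeff_eq]
    rw [hdec, hc0, add_comm]
    congr 1
    · rw [Finset.sum_eq_single u]
      · by_cases hj : j = c₀
        · subst hj; rw [if_pos rfl]; rfl
        · rw [if_neg hj, show coeff (Finsupp.single u 1) (A' w j) = coeffMat A' u w j from rfl,
            hcf u j (Or.inr hj), C_0, zero_mul]
      · intro v _ hv
        rw [show coeff (Finsupp.single v 1) (A' w j) = coeffMat A' v w j from rfl, hcf v j (Or.inl hv), C_0,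
          zero_mul]
      · intro hu; exact absurd (Finset.mem_univ u) hu
    · by_cases hj : j = e
      · subst hj; rw [if_pos rfl, hd]
      · rw [if_neg hj, hcst j hj, C_0]
  have hrow₁ := hrow w₁ e₁ u₁ hw₁ hθe₁ hd₁
  have hrow₂ := hrow w₂ e₂ u₂ hw₂ hθe₂ hd₂
  set c₁ : ℂ := coeffMat A' u₁ w₁ c₀ with hc₁
  set c₂ : ℂ := coeffMat A' u₂ w₂ c₀ with hc₂
  -- choice of the twist parameters and of the witnessing variable
  obtain ⟨α, β, vs, es, as, hαβ, has, hvs3, hN'vs, hcol⟩ :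
      ∃ (α β : ℂ) (vs : Fin m × Fin m) (es : Fin n) (as : ℂ), α * c₂ + β * c₁ = 0 ∧ as ≠ 0 ∧ vs ≠ u₃ ∧
        ((if vs = u₁ then α • Matrix.single w₃ e₂ (1 : ℂ) else 0) +
          (if vs = u₂ then β • Matrix.single w₃ e₁ (1 : ℂ) else 0) = as • Matrix.single w₃ es (1 : ℂ)) ∧
        ∀ i, coeffMat A' vs i es = 0 := by
    by_cases hc : c₁ = 0
    · refine ⟨0, 1, u₂, e₁, 1, by rw [hc]; ring, one_ne_zero, h23, ?_, fun i => ?_⟩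
      · rw [if_neg (Ne.symm h12), if_pos rfl, zero_add, one_smul]
      · by_contra hne
        have h1 := hcoeff u₂.1 u₂.2 i e₁ hne
        rw [hθe₁] at h1
        exact ne_st_add_st_of_share (hρ1 i) hsh h1
    · refine ⟨c₁, -c₂, u₁, e₂, c₁, by ring, hc, h13, ?_, fun i => ?_⟩
      · rw [if_pos rfl, if_neg h12, add_zero]
      · by_contra hne
        have h1 := hcoeff u₁.1 u₁.2 i e₂ hne
        rw [hθe₂] at h1
        exact ne_st_add_st_of_share (hρ1 i) (hsh.imp Eq.symm Eq.symm) h1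
  have hroww : ∀ j, coeffMat A' vs w₃ j = 0 := by
    intro j
    by_contra hne
    have h1 := hcoeff vs.1 vs.2 w₃ j hne
    rw [hw₃] at h1
    obtain ⟨-, hk, hl⟩ := st_eq_add_st h1
    exact hvs3 (Prod.ext hk hl).symm
  -- the twist, for every parameter `t`
  have htw := fun t : ℂ =>
    stub_rowTwist A' w₁ w₂ w₃ c₀ e₁ e₂ u₁ u₂ c₁ c₂ 1 1 α β t hw13 hw23 hrow₁ hrow₂ hαβ
  set N' : Fin m × Fin m → Matrix (Fin n) (Fin n) ℂ := fun v =>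
    (if v = u₁ then α • Matrix.single w₃ e₂ (1 : ℂ) else 0) +
      (if v = u₂ then β • Matrix.single w₃ e₁ (1 : ℂ) else 0) with hN'
  set gi : Matrix (Fin n) (Fin n) ℂ := ((g⁻¹ : GL (Fin n) ℂ) : Matrix (Fin n) (Fin n) ℂ) with hgi
  set hh : Matrix (Fin n) (Fin n) ℂ := ((h : GL (Fin n) ℂ) : Matrix (Fin n) (Fin n) ℂ) with hhh
  set N : Fin m × Fin m → Matrix (Fin n) (Fin n) ℂ := fun v => gi * N' v * hh with hN
  set p : ℂ → Matrix (Fin n) (Fin n) ℂ × (Fin m × Fin m → Matrix (Fin n) (Fin n) ℂ) :=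
    fun t => (Λ, fun v => A v + t • N v) with hp
  have hback : gi.map C * A' * hh.map C = P₀ := by
    have := inv_map_C_mul_mul_map_C_inv g h⁻¹ P₀
    rwa [inv_inv] at this
  -- the increment of the twist is the pencil of `t • N'`
  have hInc : ∀ t : ℂ, (Matrix.of fun i j => if i = w₃ then
        ((if j = e₂ then C (t * α * 1) * X u₁ else 0) + (if j = e₁ then C (t * β * 1) * X u₂ else 0)) else 0 :
          Matrix (Fin n) (Fin n) (MvPolynomial (Fin m × Fin m) ℂ)) =
      (0 : Matrix (Fin n) (Fin n) ℂ).map C + ∑ v, (X v : MvPolynomial (Fin m × Fin m) ℂ) • (t • N' v).map C := by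
    intro t
    refine Matrix.ext fun i j => ?_
    rw [Matrix.add_apply, Matrix.sum_apply,
      Finset.sum_eq_add_of_mem u₁ u₂ (Finset.mem_univ _) (Finset.mem_univ _) h12]
    · have h1 : N' u₁ = α • Matrix.single w₃ e₂ (1 : ℂ) := by
        simp only [hN']
        rw [if_pos trivial, if_neg h12, add_zero]
      have h2 : N' u₂ = β • Matrix.single w₃ e₁ (1 : ℂ) := by
        simp only [hN']
        rw [if_neg (Ne.symm h12), if_pos trivial, zero_add]
      rw [h1, h2]
      simp only [Matrix.of_apply, Matrix.smul_apply, Matrix.map_apply, Matrix.zero_apply, C_0, zero_add,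
        smul_eq_mul, Matrix.single_apply, mul_ite, mul_one, mul_zero]
      by_cases hi : i = w₃
      · subst hi
        by_cases hj2 : j = e₂
        · subst hj2
          by_cases hj1 : j = e₁
          · simp [hj1, mul_comm]
          · simp [hj1, Ne.symm hj1, mul_comm]
        · by_cases hj1 : j = e₁
          · subst hj1
            simp [hj2, Ne.symm hj2, mul_comm]
          · simp [hj1, hj2, Ne.symm hj1, Ne.symm hj2]
      · simp [hi, Ne.symm hi]
    · intro v _ hv
      have h0 : N' v = 0 := by
        simp only [hN', if_neg hv.1, if_neg hv.2, add_zero]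
      rw [h0, smul_zero, Matrix.map_zero C C_0, smul_zero, Matrix.zero_apply]
  have hpencil : ∀ t : ℂ, (p t).1.map C + ∑ v, (X v : MvPolynomial (Fin m × Fin m) ℂ) • ((p t).2 v).map C =
      gi.map C * (((1 : Matrix (Fin n) (Fin n) (MvPolynomial (Fin m × Fin m) ℂ)) + Matrix.of fun i j =>
          if i = w₃ then ((if j = w₂ then C (t * α) * X u₁ else 0) + (if j = w₁ then C (t * β) * X u₂ else 0))
          else 0) * A') * hh.map C := by
    intro t
    rw [(htw t).2, hInc t, Matrix.mul_add, Matrix.add_mul, hback, rft_map_C_mul_pencil_mul_map_C, hP₀]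
    simp only [hp, Matrix.mul_zero, Matrix.zero_mul, Matrix.map_zero C C_0, zero_add, Matrix.mul_smul,
      Matrix.smul_mul]
    rw [add_assoc, ← Finset.sum_add_distrib]
    congr 1
    refine Finset.sum_congr rfl fun v _ => ?_
    rw [← smul_add, ← Matrix.map_add C (fun _ _ => C_add)]
  have hdetp : ∀ t : ℂ, ((p t).1.map C + ∑ v, (X v : MvPolynomial (Fin m × Fin m) ℂ) • ((p t).2 v).map C).det =
      perPoly (Fin m) ℂ := by
    intro t
    rw [hpencil t, det_map_C_mul_mul_map_C, Matrix.det_mul, (htw t).1, one_mul, ← det_map_C_mul_mul_map_C,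
      hback]
    exact hdet
  -- a parameter `t ≠ 0` with `p t ∈ U`
  have hcont : Continuous p := by
    refine continuous_const.prodMk (continuous_pi fun v => ?_)
    exact continuous_const.add (continuous_id.smul continuous_const)
  have hp0 : p 0 = (Λ, A) := by simp [hp]
  have htend : Filter.Tendsto p (nhdsWithin (0 : ℂ) {0}ᶜ) (nhds (Λ, A)) := by
    rw [← hp0]; exact (hcont.tendsto 0).mono_left nhdsWithin_le_nhds
  obtain ⟨t, htU, ht0⟩ := ((htend.eventually_mem hU).and self_mem_nhdsWithin).exists
  replace ht0 : t ≠ 0 := by simpa using ht0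
  -- rigidity puts `p t` in the orbit: compare the ranks of the coefficient matrices of `x_{vs}`
  obtain ⟨g₁, h₁, -, hAv⟩ := hrig (p t) htU (hdetp t)
  have hv : A vs + t • N vs = (g₁ : Matrix (Fin n) (Fin n) ℂ) * A vs *
      ((h₁⁻¹ : GL (Fin n) ℂ) : Matrix (Fin n) (Fin n) ℂ) := by
    have := hAv vs; simpa [hp] using this
  have hrk : (A vs + t • N vs).rank = (A vs).rank := by
    rw [hv, Matrix.rank_mul_eq_left_of_isUnit_det _ _
        ((Matrix.isUnit_iff_isUnit_det _).mp (h₁⁻¹).isUnit),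
      Matrix.rank_mul_eq_right_of_isUnit_det _ _ ((Matrix.isUnit_iff_isUnit_det _).mp g₁.isUnit)]
  have hAvs : A vs = gi * coeffMat A' vs * hh := by
    rw [hcoeffA' vs, hgi, hhh]
    simp only [← Matrix.mul_assoc, Units.inv_mul, Matrix.one_mul]
    rw [Matrix.mul_assoc, Units.inv_mul, Matrix.mul_one]
  have hNvs : N vs = gi * (as • Matrix.single w₃ es (1 : ℂ)) * hh := by
    simp only [hN, hN']
    rw [hN'vs]
  have hsum : A vs + t • N vs = gi * (coeffMat A' vs + Matrix.single w₃ es (t * as)) * hh := by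
    rw [hAvs, hNvs, Matrix.mul_add, Matrix.add_mul, Matrix.smul_single, smul_eq_mul, mul_one]
    congr 1
    rw [← Matrix.smul_mul, ← Matrix.mul_smul, Matrix.smul_single, smul_eq_mul]
  have hgi_unit : IsUnit gi.det := (Matrix.isUnit_iff_isUnit_det _).mp (g⁻¹).isUnit
  have hhh_unit : IsUnit hh.det := (Matrix.isUnit_iff_isUnit_det _).mp h.isUnit
  rw [hsum, hAvs, Matrix.rank_mul_eq_left_of_isUnit_det _ _ hhh_unit,
    Matrix.rank_mul_eq_right_of_isUnit_det _ _ hgi_unit,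
    Matrix.rank_mul_eq_left_of_isUnit_det _ _ hhh_unit,
    Matrix.rank_mul_eq_right_of_isUnit_det _ _ hgi_unit] at hrk
  exact stub_rankJump (coeffMat A' vs) w₃ es (mul_ne_zero ht0 has) hroww hcol hrk

/-! ### The refutation -/

/-- **`RigidMinimalRepr` is false.** A locally rigid minimal representation of `perm_m` (`m ≥ 3`) would be
two-sided-torus-equivariant (`rigidityForcesTorus_proof`, stmt-4166), hence of size `≥ 2^m - 1`
(`stub_torusBound`, stmt-4164), hence of size exactly `2^m - 1` by Grenet's bound and minimality; but in
the tight case the Koszul row twist of the graded normal form leaves the orbit inside every neighbourhood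
(`stub_tightNotRigid`). -/
theorem not_RigidMinimalRepr : ¬ RigidMinimalRepr := by
  intro H
  obtain ⟨m, hm3, n, Λ, A, hdc, hdet, hU⟩ := H 3
  have hEq := rigidityForcesTorus_proof m hm3 n Λ A hdet hU
  have hlow : 2 ^ m - 1 ≤ n := BorderApolarityToricWitnessObstructionQP.stub_torusBound m hm3 n _ hEq
  have hup : n ≤ 2 ^ m - 1 := by
    rw [hdc]; exact determinantalComplexity_perPoly_le_holds ℂ m (by omega)
  exact stub_tightNotRigid hm3 (le_antisymm hup hlow) Λ A hdet hEq hU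

end

end Summit.ValiantsHypothesis.ValiantsHypothesis.Theorems.RigidityForcesSymmetryRigidMinimalRepr
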